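import Summits.ResolutionOfSingularities.KangarooAtlas.MizutaniExponentCriterion
import Summits.ResolutionOfSingularities.KangarooAtlas.MizutaniGenericPoint
import HarnessLib

/-!
# `cdim_{exponent}(𝔭) ≤ dim B(𝔭) ≤ cdim_0(𝔭)`, and `genPoint ⊆ frobGen`

Cell `pub-rosobs`, Mizutani enclosure (seat mizutani-encloser-1, gen 8).  AI-written; *AI review is weaker than
expert review*; NOT a resolution-of-singularities theorem (summit relevance C).

Two small complements to `MizutaniExponentBound` / `MizutaniExponentCriterion` / `MizutaniGenericPoint`:

* **`cdim_le_hsDimAt`** — `cdim_e(𝔭) ≤ (n + 1) − dim_k (L_B)_e(𝔭)` at every level (the invariant forms of level `e` lie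
  in `V_e(𝔭)`, whose dimension is `n + 1 − cdim_e` by rank–nullity), hence **`cdim_exponent_le_hsDim`**; and
  **`hsDim_le_cdim_zero`** — `dim B(𝔭) ≤ cdim_0(𝔭) = dim_k span{ξ_i}` (the linear hull of the point, `+1`): the
  Hironaka scheme sits between the Frobenius-stable hull and the linear hull of the point,
  `cdim_{exponent}(𝔭) ≤ dim B(𝔭) ≤ cdim_0(𝔭)`.
* **`genPoint_le_frobGen`** — the most generic point lies in the `q`-linear generization: `genPoint k p 𝔭 e ⊆ frobGen k p 𝔭 e ⊆ 𝔭`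
  (`W_e(𝔭) ⊆ V_e(𝔭)`); both have the scheme of `𝔭` when `e ≥ exponent`.

## References

* H. Mizutani, *Hironaka's additive group schemes*, Nagoya Math. J. 52 (1973), §1 (d), Thm. 1.3. [Mizutani1973HironakaGroupSchemes]
* T. Oda, *Hironaka's additive group scheme, II*, Publ. RIMS 19 (1983), §2 (p. 1168). [Oda1983HironakaGroupSchemeII]
-/

noncomputable section

open MvPolynomial Literature.AlgebraicGeometry.Resolution Literature.AlgebraicGeometry.Resolution.HironakaScheme
  Literature.RingTheory.MvPolynomial

namespace Summit.ResolutionOfSingularities.KangarooAtlas.Mizutani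

universe u

section Hulls

variable (k : Type u) [Field k] (p : ℕ) [hp : Fact p.Prime] [CharP k p] {n : ℕ}
  (𝔭 : Ideal (MvPolynomial (Fin (n + 1)) k))

/-- `(L_B)_e(𝔭) ⊆ V_e(𝔭)`: an invariant form lies in the point. [cite: Oda1983HironakaGroupSchemeII, §2 (p. 1168)] -/
theorem invForms_le_pointForms (e : ℕ) : invForms k p 𝔭 e ≤ pointForms k p 𝔭 e := by
  intro a ha
  rw [mem_pointForms_iff]
  exact addForm_mem_of_mem_invForms ha

/-- **`cdim_e(𝔭) ≤ (n + 1) − dim_k (L_B)_e(𝔭) = hsDimAt e`** at every level. [cite: Oda1983HironakaGroupSchemeII, §2 (p. 1168: dim B = rank of L/L_B)] -/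
theorem cdim_le_hsDimAt (e : ℕ) : cdim k p 𝔭 e ≤ hsDimAt k p 𝔭 e := by
  haveI : FiniteDimensional k (pointForms k p 𝔭 e) := FiniteDimensional.finiteDimensional_submodule _
  have h1 := cdim_add_finrank_pointForms k p 𝔭 e
  have h2 := Submodule.finrank_mono (invForms_le_pointForms k p 𝔭 e)
  unfold hsDimAt
  omega

/-- **`cdim_{exponent}(𝔭) ≤ dim B(𝔭)`** (and hence `cdim_j(𝔭) ≤ dim B(𝔭)` for all `j ≥ exponent`, `cdim_add_le`).
[cite: Mizutani1973HironakaGroupSchemes, Thm. 1.3 (dim = dim_k(L_e/N_e))] -/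
theorem cdim_exponent_le_hsDim : cdim k p 𝔭 (exponent k p 𝔭) ≤ hsDim k p 𝔭 :=
  cdim_le_hsDimAt k p 𝔭 _

/-- `(L_B)_0(𝔭) = V_0(𝔭)` (the linear forms through the point). [cite: Oda1983HironakaGroupSchemeII, §2 (p. 1168)] -/
theorem invForms_zero_eq_pointForms : invForms k p 𝔭 0 = pointForms k p 𝔭 0 := by
  ext a
  rw [mem_invForms_zero_iff, mem_pointForms_iff]

/-- `hsDimAt 0 = cdim_0` (`= dim_k span{ξ_i}`, the linear hull of the point `+ 1`). [folklore] -/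
theorem hsDimAt_zero_eq_cdim : hsDimAt k p 𝔭 0 = cdim k p 𝔭 0 := by
  have h1 := cdim_add_finrank_pointForms k p 𝔭 0
  rw [← invForms_zero_eq_pointForms] at h1
  unfold hsDimAt
  omega

/-- **`dim B(𝔭) ≤ cdim_0(𝔭)`**: the Hironaka scheme lies in the linear hull of the point (`dim_k (L_B)_e` is non-decreasing
in `e`). [cite: Mizutani1973HironakaGroupSchemes, §1 (Def. 1.1: U_+(𝔭) contains the linear forms through 𝔭)] -/
theorem hsDim_le_cdim_zero : hsDim k p 𝔭 ≤ cdim k p 𝔭 0 := by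
  rw [← hsDimAt_zero_eq_cdim]
  unfold hsDim hsDimAt
  have hmono := finrank_invForms_mono k p 𝔭 0 (exponent k p 𝔭)
  rw [Nat.zero_add] at hmono
  omega

/-- **`genPoint k p 𝔭 e ⊆ frobGen k p 𝔭 e`** (`W_e(𝔭) ⊆ V_e(𝔭)`): the most generic point lies in the `q`-linear generization.
[cite: Mizutani1973HironakaGroupSchemes, §1 (d)] -/
theorem genPoint_le_frobGen [𝔭.IsPrime] (e : ℕ) : genPoint k p 𝔭 e ≤ frobGen k p 𝔭 e := by
  have hW : genForms k p 𝔭 e ≤ pointForms k p 𝔭 e := by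
    intro v hv
    rw [mem_pointForms_iff]
    exact addForm_mem_of_mem_genForms k p 𝔭 e (fun _ _ => le_rfl) hv
  have hI : genLinIdeal k p 𝔭 e ≤ linHullIdeal k p 𝔭 e := by
    unfold genLinIdeal linHullIdeal
    exact Ideal.span_mono (Set.image_mono hW)
  unfold genPoint frobGen
  exact Ideal.comap_mono hI

/-- The chain `genPoint ⊆ frobGen ⊆ 𝔭`, all three with the same Hironaka scheme when `exponent B(𝔭) ≤ e`.
[cite: Mizutani1973HironakaGroupSchemes, §1 (d)] -/
theorem genPoint_le_frobGen_le [𝔭.IsPrime] (hP : IsPoint k 𝔭) {e : ℕ} (hE : ExponentLE k p 𝔭 e) :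
    genPoint k p 𝔭 e ≤ frobGen k p 𝔭 e ∧ frobGen k p 𝔭 e ≤ 𝔭 ∧
      (haveI := isPrime_genPoint k p 𝔭 e; bIdeal k (genPoint k p 𝔭 e)) = bIdeal k 𝔭 ∧
      (haveI := isPrime_frobGen k p 𝔭 e; bIdeal k (frobGen k p 𝔭 e)) = bIdeal k 𝔭 :=
  ⟨genPoint_le_frobGen k p 𝔭 e, frobGen_le k p 𝔭 e, bIdeal_genPoint_eq k p 𝔭 e hP hE, bIdeal_frobGen_eq k p 𝔭 e hP hE⟩

end Hulls

end Summit.ResolutionOfSingularities.KangarooAtlas.Mizutani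

end
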